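import Summits.KontsevichZagierPeriods.KontsevichZagierPeriods.Theorems.SoloBlindCauchySemialgebraic
import Mathlib.MeasureTheory.Constructions.HaarToSphere
import Mathlib.Analysis.SpecialFunctions.ImproperIntegrals
import Mathlib.Analysis.SpecialFunctions.Integrability.Basic
import HarnessLib

/-!
# Cauchy's theorem inside the rules, III: the surface term `∬ h` converges absolutely

For `-1 < e < -1/2` the mixed derivative `h = -Im g_e'` of `g_e(z) = (z(1-z))^e` is absolutely
integrable on the open half-plane `D = {x < 1/2, y > 0}`: `|g_e'(z)| ≤ 2|z|^{e-1}|1-z|^e`, hence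
`|h| ≤ 4 r^{e-1}` for `r = max(|x|,|y|) ≤ 1` and `|h| ≤ 4 r^{2e-1}` for `r ≥ 1`, a radial profile
which is integrable in the plane (polar coordinates, `∫₀¹ r^e dr + ∫₁^∞ r^{2e} dr < ∞`).  With the
semialgebraicity of `h` at level `5` (`SoloBlindCauchySemialgebraic`) this makes `[D, h_p]`
(`e = p/5 - 1`, `p = 1, 2`) an admissible `2`-dimensional Kontsevich–Zagier representation —
the common refinement on which the two Newton–Leibniz moves of Green's formula act.

References: Kontsevich–Zagier, *Periods* (2001), §1.1–1.2.
-/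

noncomputable section

namespace Summit.KontsevichZagierPeriods.KontsevichZagierPeriods.Theorems

open Set Complex MeasureTheory Filter
open Literature.ModelTheory.ExponentialFields (IsSemialgebraic isSemialgebraic_setOf_eval_pos)
open MvPolynomial (aeval X)
open Literature.NumberTheory.Transcendental
open Literature.NumberTheory.Transcendental.KZ

namespace SoloBlind

/-! ## The pointwise bound on `g_e'` -/

/-- `|z| ≤ |1 - z|` for `Re z < 1/2`. -/
theorem norm_le_norm_one_sub {z : ℂ} (hx : z.re < 1 / 2) : ‖z‖ ≤ ‖1 - z‖ := by
  have h1 : ‖z‖ ^ 2 ≤ ‖1 - z‖ ^ 2 := by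
    rw [Complex.sq_norm, Complex.sq_norm, Complex.normSq_apply, Complex.normSq_apply]
    simp only [sub_re, one_re, sub_im, one_im, zero_sub, mul_neg, neg_mul, neg_neg]
    nlinarith
  exact (pow_le_pow_iff_left₀ (norm_nonneg _) (norm_nonneg _) two_ne_zero).mp h1

/-- `1/2 ≤ |1 - z|` for `Re z < 1/2`. -/
theorem half_le_norm_one_sub {z : ℂ} (hx : z.re < 1 / 2) : 1 / 2 ≤ ‖1 - z‖ := by
  refine le_trans ?_ (abs_re_le_norm (1 - z))
  rw [sub_re, one_re]
  exact le_trans (by linarith) (le_abs_self _)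

/-- **Pointwise bound.** `|g_e'(z)| ≤ 2 |z|^{e-1} |1-z|^e` for `-1 ≤ e ≤ 0`, `Re z < 1/2`,
`z ≠ 0`. -/
theorem norm_gDer_le {e : ℝ} (he1 : -1 ≤ e) (he0 : e ≤ 0) {z : ℂ} (hx : z.re < 1 / 2)
    (hz : z ≠ 0) : ‖gDer e z‖ ≤ 2 * (‖z‖ ^ (e - 1) * ‖1 - z‖ ^ e) := by
  have hb : 0 < ‖1 - z‖ := lt_of_lt_of_le (by norm_num) (half_le_norm_one_sub hx)
  have ha : 0 < ‖z‖ := norm_pos_iff.mpr hz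
  have hexp : ((e : ℂ) - 1) = ((e - 1 : ℝ) : ℂ) := by push_cast; ring
  rw [gDer, hexp, norm_mul, norm_mul, norm_cpow_real, wOf, norm_mul, Real.mul_rpow ha.le hb.le,
    Complex.norm_real, Real.norm_eq_abs]
  have h12 : ‖1 - 2 * z‖ ≤ 2 * ‖1 - z‖ := by
    calc ‖1 - 2 * z‖ = ‖(1 - z) + -z‖ := by ring_nf
      _ ≤ ‖1 - z‖ + ‖-z‖ := norm_add_le _ _
      _ ≤ 2 * ‖1 - z‖ := by rw [norm_neg]; linarith [norm_le_norm_one_sub hx]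
  have hee : |e| ≤ 1 := abs_le.mpr ⟨by linarith, by linarith⟩
  have hsplit : ‖1 - z‖ ^ (e - 1) * ‖1 - z‖ = ‖1 - z‖ ^ e := by
    rw [Real.rpow_sub_one hb.ne', div_mul_cancel₀ _ hb.ne']
  have hA : 0 ≤ ‖z‖ ^ (e - 1) := Real.rpow_nonneg ha.le _
  have hB : 0 ≤ ‖1 - z‖ ^ (e - 1) := Real.rpow_nonneg hb.le _
  calc |e| * (‖z‖ ^ (e - 1) * ‖1 - z‖ ^ (e - 1)) * ‖1 - 2 * z‖
      ≤ 1 * (‖z‖ ^ (e - 1) * ‖1 - z‖ ^ (e - 1)) * (2 * ‖1 - z‖) := by gcongr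
    _ = 2 * (‖z‖ ^ (e - 1) * (‖1 - z‖ ^ (e - 1) * ‖1 - z‖)) := by ring
    _ = 2 * (‖z‖ ^ (e - 1) * ‖1 - z‖ ^ e) := by rw [hsplit]

/-- The dominating radial profile: `4 r^{e-1}` for `r ≤ 1`, `4 r^{2e-1}` for `r > 1`. -/
def prof (e r : ℝ) : ℝ := 4 * (if r ≤ 1 then r ^ (e - 1) else r ^ (2 * e - 1))

/-- **Radial domination** in the sup norm of `ℝ²`: `|g_e'(x+iy)| ≤ prof e ‖(x,y)‖` on the open
half-plane `x < 1/2`, `y > 0`. -/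
theorem norm_gDer_le_prof {e : ℝ} (he1 : -1 ≤ e) (he0 : e ≤ 0) {z : Fin 2 → ℝ}
    (hx : z 0 < 1 / 2) (hy : 0 < z 1) : ‖gDer e ((z 0 : ℂ) + z 1 * I)‖ ≤ prof e ‖z‖ := by
  set ζ : ℂ := (z 0 : ℂ) + z 1 * I with hζ
  have hre : ζ.re = z 0 := by simp [hζ]
  have him : ζ.im = z 1 := by simp [hζ]
  have hζ0 : ζ ≠ 0 := by
    intro h
    have := congrArg Complex.im h
    rw [him, zero_im] at this
    exact hy.ne' this
  have hr0 : 0 < ‖z‖ :=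
    lt_of_lt_of_le (by rw [Real.norm_eq_abs, abs_of_pos hy]; exact hy) (norm_le_pi_norm z 1)
  have hrz : ‖z‖ ≤ ‖ζ‖ := by
    refine (pi_norm_le_iff_of_nonneg (norm_nonneg ζ)).mpr fun i => ?_
    fin_cases i
    · simpa [hre, Real.norm_eq_abs] using abs_re_le_norm ζ
    · simpa [him, Real.norm_eq_abs] using abs_im_le_norm ζ
  have hxζ : ζ.re < 1 / 2 := by rw [hre]; exact hx
  have hb := norm_gDer_le he1 he0 hxζ hζ0
  have h1z : ‖ζ‖ ≤ ‖1 - ζ‖ := norm_le_norm_one_sub hxζ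
  have hhalf : 1 / 2 ≤ ‖1 - ζ‖ := half_le_norm_one_sub hxζ
  have hζpos : 0 < ‖ζ‖ := norm_pos_iff.mpr hζ0
  have hA : ‖ζ‖ ^ (e - 1) ≤ ‖z‖ ^ (e - 1) := Real.rpow_le_rpow_of_nonpos hr0 hrz (by linarith)
  have hAn : 0 ≤ ‖ζ‖ ^ (e - 1) := Real.rpow_nonneg (norm_nonneg _) _
  have hzn : 0 ≤ ‖z‖ ^ (e - 1) := Real.rpow_nonneg (norm_nonneg _) _
  rw [prof]
  split_ifs with hr
  · by_cases hζ1 : ‖ζ‖ ≤ 1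
    · have hB : ‖1 - ζ‖ ^ e ≤ 2 := by
        calc ‖1 - ζ‖ ^ e ≤ (1 / 2 : ℝ) ^ e := Real.rpow_le_rpow_of_nonpos (by norm_num) hhalf he0
          _ = 2 ^ (-e) := by
            rw [one_div, Real.inv_rpow (by norm_num), Real.rpow_neg (by norm_num)]
          _ ≤ 2 ^ (1 : ℝ) := Real.rpow_le_rpow_of_exponent_le (by norm_num) (by linarith)
          _ = 2 := Real.rpow_one 2
      calc ‖gDer e ζ‖ ≤ 2 * (‖ζ‖ ^ (e - 1) * ‖1 - ζ‖ ^ e) := hb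
        _ ≤ 2 * (‖z‖ ^ (e - 1) * 2) := by gcongr
        _ = 4 * ‖z‖ ^ (e - 1) := by ring
    · push Not at hζ1
      have hB : ‖1 - ζ‖ ^ e ≤ 1 :=
        (Real.rpow_le_rpow_of_nonpos hζpos h1z he0).trans
          (Real.rpow_le_one_of_one_le_of_nonpos hζ1.le he0)
      have hA' : ‖ζ‖ ^ (e - 1) ≤ 1 := Real.rpow_le_one_of_one_le_of_nonpos hζ1.le (by linarith)
      have hC : 1 ≤ ‖z‖ ^ (e - 1) :=
        Real.one_le_rpow_of_pos_of_le_one_of_nonpos hr0 hr (by linarith)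
      calc ‖gDer e ζ‖ ≤ 2 * (‖ζ‖ ^ (e - 1) * ‖1 - ζ‖ ^ e) := hb
        _ ≤ 2 * (1 * 1) := by gcongr
        _ ≤ 4 * ‖z‖ ^ (e - 1) := by linarith
  · push Not at hr
    have hζ1 : 1 < ‖ζ‖ := lt_of_lt_of_le hr hrz
    have hB : ‖1 - ζ‖ ^ e ≤ ‖ζ‖ ^ e := Real.rpow_le_rpow_of_nonpos hζpos h1z he0
    have hprod : ‖ζ‖ ^ (e - 1) * ‖ζ‖ ^ e = ‖ζ‖ ^ (2 * e - 1) := by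
      rw [← Real.rpow_add hζpos]; congr 1; ring
    have hD : ‖ζ‖ ^ (2 * e - 1) ≤ ‖z‖ ^ (2 * e - 1) :=
      Real.rpow_le_rpow_of_nonpos hr0 hrz (by linarith)
    calc ‖gDer e ζ‖ ≤ 2 * (‖ζ‖ ^ (e - 1) * ‖1 - ζ‖ ^ e) := hb
      _ ≤ 2 * (‖ζ‖ ^ (e - 1) * ‖ζ‖ ^ e) := by gcongr
      _ = 2 * ‖ζ‖ ^ (2 * e - 1) := by rw [hprod]
      _ ≤ 4 * ‖z‖ ^ (2 * e - 1) := by nlinarith [Real.rpow_nonneg hr0.le (2 * e - 1)]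

/-- The radial profile is integrable in the plane for `-1 < e < -1/2` (polar coordinates). -/
theorem integrable_prof {e : ℝ} (he1 : -1 < e) (he2 : e < -1 / 2) :
    Integrable (fun z : Fin 2 → ℝ => prof e ‖z‖) := by
  refine (integrable_fun_norm_addHaar volume).mpr ?_
  have hdim : Module.finrank ℝ (Fin 2 → ℝ) - 1 = 1 := by simp
  rw [hdim, ← Ioc_union_Ioi_eq_Ioi zero_le_one, integrableOn_union]
  simp only [pow_one, smul_eq_mul]
  constructor
  · have h := (intervalIntegral.intervalIntegrable_rpow' he1 (a := 0) (b := 1)).const_mul 4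
    rw [intervalIntegrable_iff_integrableOn_Ioc_of_le zero_le_one] at h
    refine h.congr_fun (fun y hy => ?_) measurableSet_Ioc
    show 4 * y ^ e = y * prof e y
    have hy0 : y ≠ 0 := hy.1.ne'
    rw [prof, if_pos hy.2, Real.rpow_sub_one hy0, mul_div_assoc' 4, mul_div_cancel₀ _ hy0]
  · have h : IntegrableOn (fun y : ℝ => 4 * y ^ (2 * e)) (Ioi 1) :=
      (integrableOn_Ioi_rpow_of_lt (by linarith : 2 * e < -1) zero_lt_one).const_mul 4
    refine h.congr_fun (fun y hy => ?_) measurableSet_Ioi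
    have hy1 : (1 : ℝ) < y := hy
    have hy0 : y ≠ 0 := by linarith
    show 4 * y ^ (2 * e) = y * prof e y
    rw [prof, if_neg (not_le.mpr hy1), Real.rpow_sub_one hy0, mul_div_assoc' 4,
      mul_div_cancel₀ _ hy0]

/-! ## The open half-plane and the representation `[D, h_p]` -/

/-- The open half-plane `D = {x < 1/2, y > 0} ⊆ ℝ²`. -/
def Dom : Set (Fin 2 → ℝ) := {z | z 0 < 1 / 2 ∧ 0 < z 1}

/-- `D` is open. -/
theorem isOpen_Dom : IsOpen Dom :=
  (isOpen_lt (continuous_apply 0) continuous_const).inter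
    (isOpen_lt continuous_const (continuous_apply 1))

/-- `D` is `ℚ`-semialgebraic. -/
theorem isSemialgebraic_Dom : IsSemialgebraic ℚ Dom := by
  have h1 := isSemialgebraic_setOf_eval_pos (k := ℚ) (R := ℝ) (1 - 2 * X 0 : MvPolynomial (Fin 2) ℚ)
  have h2 := isSemialgebraic_setOf_eval_pos (k := ℚ) (R := ℝ) (X 1 : MvPolynomial (Fin 2) ℚ)
  refine (congrArg (IsSemialgebraic (R := ℝ) ℚ) ?_).mpr (h1.inter h2)
  ext q
  simp only [Dom, mem_setOf_eq, mem_inter_iff, map_sub, map_mul, map_one, MvPolynomial.aeval_X,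
    map_ofNat]
  constructor
  · rintro ⟨h1, h2⟩; exact ⟨by linarith, h2⟩
  · rintro ⟨h1, h2⟩; exact ⟨by linarith, h2⟩

/-- `D ⊆ Eup`. -/
theorem Dom_subset_Eup : Dom ⊆ Eup := fun _ hz => ⟨hz.2.le, hz.1.le, Or.inl hz.2⟩

/-- `g_e'` is continuous on `D` (there `w ∈ slitPlane`). -/
theorem continuousOn_gDer (e : ℝ) :
    ContinuousOn (fun z : Fin 2 → ℝ => gDer e ((z 0 : ℂ) + z 1 * I)) Dom := by
  intro z hz
  have hsl : wOf ((z 0 : ℂ) + z 1 * I) ∈ slitPlane := wOf_mem_slitPlane hz.1 hz.2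
  have hζ : Continuous fun z : Fin 2 → ℝ => (z 0 : ℂ) + z 1 * I := by fun_prop
  apply ContinuousAt.continuousWithinAt
  have h1 : ContinuousAt (fun z : Fin 2 → ℝ => wOf ((z 0 : ℂ) + z 1 * I) ^ ((e : ℂ) - 1)) z :=
    ContinuousAt.comp (f := fun z : Fin 2 → ℝ => wOf ((z 0 : ℂ) + z 1 * I))
      (continuousAt_cpow_const hsl) (continuous_wOf.comp hζ).continuousAt
  show ContinuousAt (fun z : Fin 2 → ℝ =>
    (e : ℂ) * wOf ((z 0 : ℂ) + z 1 * I) ^ ((e : ℂ) - 1) * (1 - 2 * ((z 0 : ℂ) + z 1 * I))) z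
  exact (continuousAt_const.mul h1).mul
    (continuousAt_const.sub (continuousAt_const.mul hζ.continuousAt))

/-- `h_p` is continuous on `D`. -/
theorem continuousOn_Hz (p : ℕ) : ContinuousOn (Hz p) Dom :=
  (Complex.continuous_im.comp_continuousOn (continuousOn_gDer ((p : ℝ) / 5 - 1))).neg

/-- **`h_p` is absolutely integrable on `D`** for `p = 1, 2`. -/
theorem integrableOn_Hz (p : ℕ) (hp : p = 1 ∨ p = 2) : IntegrableOn (Hz p) Dom := by
  have he1 : -1 < (p : ℝ) / 5 - 1 := by rcases hp with rfl | rfl <;> norm_num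
  have he2 : (p : ℝ) / 5 - 1 < -1 / 2 := by rcases hp with rfl | rfl <;> norm_num
  refine Integrable.mono' (integrable_prof he1 he2).integrableOn
    ((continuousOn_Hz p).aestronglyMeasurable isOpen_Dom.measurableSet) ?_
  refine (ae_restrict_iff' isOpen_Dom.measurableSet).mpr (Eventually.of_forall fun z hz => ?_)
  rw [Real.norm_eq_abs, Hz, abs_neg]
  exact (abs_im_le_norm _).trans (norm_gDer_le_prof he1.le (by linarith) hz.1 hz.2)

/-- **The representation `[D, h_p]`** (`p = 1, 2`): the absolutely convergent integral of the
`ℚ`-semialgebraic function `h_p = ∂P_p/∂y = -∂Q_p/∂x` over the open half-plane `D`. -/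
def cauchyRep (p : ℕ) (hp : p = 1 ∨ p = 2) : IntegralRep 2 where
  domain := Dom
  integrand := Hz p
  isSemialgebraic_domain := isSemialgebraic_Dom
  isSemialgebraicFunOn_integrand := (sa_Hz p).mono Dom_subset_Eup isSemialgebraic_Dom
  integrableOn := integrableOn_Hz p hp

end SoloBlind

end Summit.KontsevichZagierPeriods.KontsevichZagierPeriods.Theorems
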